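import Summits.CriticalPhenomena.PercolationContinuityZ3.Theorems.Transplant.FKConnectivityAllQForestDetour
import HarnessLib

/-!
# Pinning monotonicity of the detour slack (DL-CM, NOT asserted) and the arrow DL-CM ⇒ the detour lemma

Support file (`--supports stmt-CriticalPhenomena-4575`), FK sub-lane `prim-bschramm-fk-1` (generation 31) of the post-continuity
programme; builds on p205010 (kernel theorem, internal audit signed; external expert review pending).  One counting node (NOT asserted),
one arrow; no named facts, no sorries; standard axioms.

For a fibre `(M, u₀)`, a pair `e = ov` and a vertex `w` put (cf. `DetourOn`, `…ForestDetour`)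
`X(M,u₀) := #(Fo ∩ {e ∈ ω} ∩ {o ≁ w}, Fo ∩ {o ~ v})`, `Y(M,u₀) := #(Fo ∩ {e ∈ ω}, Fo ∩ {o ~ v} ∩ {o ≁ w})`; the detour lemma is `Y ≤ X`.
**DL-CM = `DetourPinMonoOn V` (conjecture-shaped, NOT asserted):** PINNING a free pair `g ∉ {ov, ow, vw}` (moving it from `M` to `u₀`,
i.e. contracting it in both classes) does not increase the slack: `X(M∖g, u₀∪g) + Y(M,u₀) ≤ X(M,u₀) + Y(M∖g, u₀∪g)`.
This is the exact analogue, for the detour slack, of g25's contraction monotonicity S₂-CM of the same-class-preference correlation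
(memo bschramm/FROM-fk-1-g25-HUB-PAIR-DECOMPOSITION.md §2d).  EVIDENCE (exact, exhaustive, isomorph-free; engine numerics31/dlcm/dlcm.c of the
seat, validated against an independent enumerator): every connected simple graph with n ≤ 9 vertices, every `(o, e, w)`, every far pair
(`g ∩ {o,v,w} = ∅`; n = 9: 35,685,130 tests) and every near pair (one end in `{o,v,w}`; n = 9: 33,191,704 tests): 0 failures (14.2M equalities);
random multigraph / pre-pinned fibres n ≤ 8: 727k tests, 0 failures; n = 10 exhaustive: kit (memo bschramm/FROM-fk-1-g31-DETOUR.md).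
**THE ARROW `detourOn_of_pinMono : DetourPinMonoOn V → DetourOn V`**: pin the free non-terminal pairs one at a time (the slack never
increases); when only `e`, `ow`, `vw` are free, every second-class detour from `o` to `v` passes through `w`, so `Y = 0` (**`detour_base`**).
Hence H1′ at kvy = 2 (`…ForestDetourTwoCell`) ⟸ DL ⟸ DL-CM.
[cite: SempleWelsh2008, Conj. 1.1 (p. 2); Thm. 4.2 (p. 11)] [cite: Linusson2011, Prop. 2.6] [cite: Grimmett2006, §1.5 (p. 13)]
-/

noncomputable section

namespace Summit.CriticalPhenomena.PercolationContinuityZ3.Theorems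
namespace FK

open Set Literature.Probability.LatticeModels Literature.Probability.Percolation
open BHK2006 (openGraph_le)
open scoped Classical symmDiff

variable {V : Type*} [Fintype V]

/-! ### The node -/

/-- **DL-CM — pinning monotonicity of the detour slack on the vertex type `V`** (conjecture-shaped, NOT asserted): for every fibre `(M,u₀)`,
pair `e = ov`, vertex `w` and free pair `g ∈ M` other than `ov, ow, vw`,
`X(M∖g, u₀∪g) + Y(M,u₀) ≤ X(M,u₀) + Y(M∖g, u₀∪g)` with `X = #(Fo ∩ {e∈ω} ∩ {o≁w}, Fo ∩ {o~v})`, `Y = #(Fo ∩ {e∈ω}, Fo ∩ {o~v} ∩ {o≁w})`.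
[cite: SempleWelsh2008, Conj. 1.1 (p. 2)] [cite: Linusson2011, Prop. 2.6] -/
def DetourPinMonoOn (V : Type*) [Fintype V] : Prop :=
  ∀ (M u₀ : BondConfig V), Disjoint u₀ M → ∀ (o v w : V) (g : Sym2 V), g ∈ M → g ≠ s(o, v) → g ≠ s(o, w) → g ≠ s(v, w) →
    fibreCount (M \ {g}) (insert g u₀) (forestEv V ∩ {ω | s(o, v) ∈ ω} ∩ (reachEv o w)ᶜ) (forestEv V ∩ reachEv o v) +
        fibreCount M u₀ (forestEv V ∩ {ω | s(o, v) ∈ ω}) (forestEv V ∩ reachEv o v ∩ (reachEv o w)ᶜ) ≤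
      fibreCount M u₀ (forestEv V ∩ {ω | s(o, v) ∈ ω} ∩ (reachEv o w)ᶜ) (forestEv V ∩ reachEv o v) +
        fibreCount (M \ {g}) (insert g u₀) (forestEv V ∩ {ω | s(o, v) ∈ ω}) (forestEv V ∩ reachEv o v ∩ (reachEv o w)ᶜ)

/-- **DL-CM on every finite vertex type.**  CONJECTURE-SHAPED, NOT asserted (evidence in the module docstring).
[cite: SempleWelsh2008, Conj. 1.1 (p. 2); Thm. 4.2 (p. 11)] -/
@[conjecture] def DetourPinMonoPos : Prop := ∀ n : ℕ, DetourPinMonoOn (Fin n)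

/-! ### The base: only `e`, `ow`, `vw` free -/

section Base

variable {M u₀ : BondConfig V} {o v w : V}

/-- **The base of the pinning induction**: if every free pair is `ov`, `ow` or `vw`, then no colouring with `ov` in the first class has a
second class joining `o` to `v` while avoiding `w` — so `Y(M,u₀) = 0`. [cite: Grimmett2006, §1.5 (p. 13)] [cite: Linusson2011, Prop. 2.6] -/
theorem detour_base (heu : s(o, v) ∉ u₀) (hM : ∀ g ∈ M, g = s(o, v) ∨ g = s(o, w) ∨ g = s(v, w)) :
    fibreCount M u₀ (forestEv V ∩ {ω | s(o, v) ∈ ω}) (forestEv V ∩ reachEv o v ∩ (reachEv o w)ᶜ) = 0 := by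
  refine fibreCount_eq_zero_of_forall _ _ _ _ fun ω hω hA hB => ?_
  obtain ⟨hF, he⟩ := hA
  obtain ⟨⟨-, hov⟩, how⟩ := hB
  have hov' : (openGraph (ω ∆ M)).Reachable o v := hov
  have how' : ¬ (openGraph (ω ∆ M)).Reachable o w := how
  -- `e ∈ M` (it lies in `ω` but not in `u₀`), hence `e ∉ ω ∆ M`
  have heM : s(o, v) ∈ M := (mem_union_of_fibre hω he).resolve_right heu
  have heη : s(o, v) ∉ ω ∆ M := fun h' => by
    rw [Set.mem_symmDiff] at h'
    rcases h' with ⟨-, h''⟩ | ⟨-, h''⟩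
    · exact h'' heM
    · exact h'' he
  -- remove `ow`, then `vw`, from the detour: it survives (a detour through them would reach `w`)
  set η₁ : BondConfig V := (ω ∆ M) \ {s(o, w)} with hη₁
  have h1 : (openGraph η₁).Reachable o v := by
    rcases reachable_sdiff_or_detour (ω ∆ M) o w hov' with h' | ⟨-, h2'⟩
    · exact h'
    · rcases h2' with h2' | h2'
      · exact h2'
      · exact absurd (hov'.trans (h2'.mono (openGraph_le sdiff_subset)).symm) how'
  set η₂ : BondConfig V := η₁ \ {s(v, w)} with hη₂
  have how₁ : ¬ (openGraph η₁).Reachable o w := fun h' => how' (h'.mono (openGraph_le sdiff_subset))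
  have h2 : (openGraph η₂).Reachable o v := by
    rcases reachable_sdiff_or_detour η₁ v w h1 with h' | ⟨h1', -⟩
    · exact h'
    · rcases h1' with h1' | h1'
      · exact h1'
      · exact absurd (h1'.mono (openGraph_le sdiff_subset)) how₁
  -- what is left of the detour lies in `ω ∖ {e}`
  have hsub : η₂ ⊆ ω \ {s(o, v)} := by
    intro x hx
    have hx1 : x ∈ ω ∆ M := hx.1.1
    have hxow : x ≠ s(o, w) := fun h' => hx.1.2 h'
    have hxvw : x ≠ s(v, w) := fun h' => hx.2 h'
    have hxe : x ≠ s(o, v) := fun h' => heη (h' ▸ hx1)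
    rw [Set.mem_symmDiff] at hx1
    rcases hx1 with ⟨hxω, -⟩ | ⟨hxM, -⟩
    · exact ⟨hxω, hxe⟩
    · rcases hM x hxM with h' | h' | h'
      · exact absurd h' hxe
      · exact absurd h' hxow
      · exact absurd h' hxvw
  have h3 : (openGraph (ω \ {s(o, v)})).Reachable o v := h2.mono (openGraph_le hsub)
  -- but `ω` is a forest through `e`
  have he' : s(o, v) ∈ ω := he
  have hback : insert s(o, v) (ω \ {s(o, v)}) = ω := by rw [insert_sdiff_singleton, insert_eq_of_mem he']
  have hov_ne : o ≠ v := by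
    intro h'
    exact not_mem_of_isForestCfg_of_isDiag hF (Sym2.mk_isDiag_iff.2 h') he'
  exact ((isForestCfg_insert_iff hov_ne (fun h' => h'.2 rfl)).1 (hback.symm ▸ hF)).2 h3

end Base

/-! ### The arrow -/

section Arrow

variable {o v w : V}

/-- **DL-CM ⇒ DL.**  Pin the free pairs other than `ov, ow, vw` one at a time; the slack `X − Y` never increases (`DetourPinMonoOn`), and
at the end `Y = 0` (`detour_base`).  (If `ov` is pinned the two sides of DL agree by the class swap; if `ov` is absent both vanish.)
[cite: SempleWelsh2008, Conj. 1.1 (p. 2); Thm. 4.2 (p. 11)] [cite: Linusson2011, Prop. 2.6] -/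
theorem detourOn_of_pinMono (hP : DetourPinMonoOn V) : DetourOn V := by
  intro M u₀ hd o v w
  -- `e` pinned: equality by the swap; `e` absent: both sides vanish
  by_cases heu : s(o, v) ∈ u₀
  · refine le_of_eq ?_
    rw [fibreCount_swap]
    refine fibreCount_congr_fibre M u₀ fun ω hω => ?_
    have he : s(o, v) ∈ ω := subset_of_fibre hω heu
    have heM : s(o, v) ∉ M := fun h' => Set.disjoint_left.1 hd heu h'
    have he' : s(o, v) ∈ ω ∆ M := Set.mem_symmDiff.2 (Or.inl ⟨he, heM⟩)
    have hR : ∀ {ξ : BondConfig V}, IsForestCfg ξ → s(o, v) ∈ ξ → (openGraph ξ).Reachable o v := fun hF h =>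
      ((openGraph_adj _ _ _).2 ⟨h, fun h' => not_mem_of_isForestCfg_of_isDiag hF (Sym2.mk_isDiag_iff.2 h') h⟩).reachable
    constructor
    · rintro ⟨⟨⟨hA, -⟩, how⟩, hB, -⟩
      exact ⟨⟨⟨hA, he⟩, how⟩, hB, hR hB he'⟩
    · rintro ⟨⟨⟨hA, -⟩, how⟩, hB, -⟩
      exact ⟨⟨⟨hA, hR hA he⟩, how⟩, hB, he'⟩
  -- the induction on the number of free non-terminal pairs
  suffices key : ∀ (k : ℕ) (M u₀ : BondConfig V), Disjoint u₀ M → s(o, v) ∉ u₀ →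
      {g | g ∈ M ∧ g ≠ s(o, v) ∧ g ≠ s(o, w) ∧ g ≠ s(v, w)}.ncard = k →
      fibreCount M u₀ (forestEv V ∩ {ω | s(o, v) ∈ ω}) (forestEv V ∩ reachEv o v ∩ (reachEv o w)ᶜ) ≤
        fibreCount M u₀ (forestEv V ∩ {ω | s(o, v) ∈ ω} ∩ (reachEv o w)ᶜ) (forestEv V ∩ reachEv o v) from
    key _ M u₀ hd heu rfl
  intro k
  induction k with
  | zero =>
    intro M u₀ hd heu hk
    have hfin : {g | g ∈ M ∧ g ≠ s(o, v) ∧ g ≠ s(o, w) ∧ g ≠ s(v, w)}.Finite := Set.toFinite _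
    have hempty := (Set.ncard_eq_zero hfin).1 hk
    have hM : ∀ g ∈ M, g = s(o, v) ∨ g = s(o, w) ∨ g = s(v, w) := by
      intro g hg
      by_contra h'
      simp only [not_or] at h'
      have : g ∈ ({g | g ∈ M ∧ g ≠ s(o, v) ∧ g ≠ s(o, w) ∧ g ≠ s(v, w)} : Set (Sym2 V)) := ⟨hg, h'.1, h'.2.1, h'.2.2⟩
      rw [hempty] at this
      exact this
    rw [detour_base heu hM]
    exact Nat.zero_le _
  | succ k ih =>
    intro M u₀ hd heu hk
    have hfin : {g | g ∈ M ∧ g ≠ s(o, v) ∧ g ≠ s(o, w) ∧ g ≠ s(v, w)}.Finite := Set.toFinite _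
    obtain ⟨g, hg⟩ : {g | g ∈ M ∧ g ≠ s(o, v) ∧ g ≠ s(o, w) ∧ g ≠ s(v, w)}.Nonempty := by
      rw [← Set.ncard_pos hfin, hk]; exact Nat.succ_pos _
    obtain ⟨hgM, hge, hgow, hgvw⟩ := hg
    have hgu : g ∉ u₀ := fun h' => Set.disjoint_left.1 hd h' hgM
    have hd' : Disjoint (insert g u₀) (M \ {g}) := by
      rw [Set.disjoint_insert_left]
      exact ⟨fun h' => h'.2 rfl, Disjoint.mono_right sdiff_subset hd⟩
    have heu' : s(o, v) ∉ insert g u₀ := fun h' => by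
      rcases mem_insert_iff.1 h' with h'' | h''
      · exact hge h''.symm
      · exact heu h''
    have hk' : {g' | g' ∈ M \ {g} ∧ g' ≠ s(o, v) ∧ g' ≠ s(o, w) ∧ g' ≠ s(v, w)}.ncard = k := by
      have hset : {g' | g' ∈ M \ {g} ∧ g' ≠ s(o, v) ∧ g' ≠ s(o, w) ∧ g' ≠ s(v, w)} =
          {g' | g' ∈ M ∧ g' ≠ s(o, v) ∧ g' ≠ s(o, w) ∧ g' ≠ s(v, w)} \ {g} := by
        ext x
        simp only [mem_setOf_eq, mem_sdiff, mem_singleton_iff]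
        tauto
      have hgin : g ∈ ({g' | g' ∈ M ∧ g' ≠ s(o, v) ∧ g' ≠ s(o, w) ∧ g' ≠ s(v, w)} : Set (Sym2 V)) := ⟨hgM, hge, hgow, hgvw⟩
      rw [hset, Set.ncard_sdiff_singleton_of_mem hgin, hk]
      rfl
    have step := hP M u₀ hd o v w g hgM hge hgow hgvw
    have ih' := ih (M \ {g}) (insert g u₀) hd' heu' hk'
    omega

end Arrow

end FK
end Summit.CriticalPhenomena.PercolationContinuityZ3.Theorems

end
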